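import Summits.CriticalPhenomena.PercolationContinuityZ3.Theorems.PercNearOneGluingNoHeavyLowerTailKNConj4PreMargin
import Summits.CriticalPhenomena.PercolationContinuityZ3.Theorems.PercNearOneGluingNoHeavyLowerTailCSHTheoremOne
import Literature.Probability.Percolation.KozmaNitzanClusterSizeReduction
import HarnessLib

/-!
# `NoHeavyLowerTail` (stmt-CriticalPhenomena-4575) — Kozma–Nitzan's pre-FKG Conjecture 4 for EVERY relay set, from the
# conditioned slack hierarchy (assembly: the printed shape)

Support file (`--supports stmt-CriticalPhenomena-4575`), prover `prim-ineq-gen-6` (gen 8; memo `prim-ineq-gen-6/FINDING-G8.md` §4).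
No definitions, no named facts, no sorries; standard axioms.  Sequel of `…KNConj4PreMargin.lean`.

Kozma–Nitzan, arXiv:2401.12397, CONJECTURE 4 (p. 32): for every monotone cluster property `f(v,ω) = F(C_ω(v))`, every relay set `A` and every
`0`, `E[f(0); 0 ↔ A] ≥ min_{a∈A} E[f(a); 0 ↔ A]` (Conjecture 2 / display (3) and Question 7 are the case `F = 1{b ∈ ·}`).
`PreFKGSurplus.kn_conj4_of_csh`: for EVERY `A` (non-degenerate weights), witness `c = argmin_a E F(C(a))` (or `0` if `0 ∈ A`), from prim-hp-8's
conditioned slack hierarchy (hypothesis `hCSH` = memo Theorem 1, to be discharged by `CSH.cshHolds_of_unfold`): peel one relay `k ≠ c`,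
`Δ_0(A) = Δ_0(A∖k) + T_k(0)`; vdBHK Thm 1.3 for `C_k` given `k ↮ A∖k` with the projected functional (tower, `CovTau.setIntegral_sub_eq_projFun`) gives
`μ(k↮A∖k)·T_k(0) ≥ μ(k↮A∖k, k↔0)·((m_k − m_c) − Δ_k(A∖k))`, and the two-observer pre-FKG margin at `D = []` (`PreFKGSurplus.preMargin_nonneg_of_csh`)
gives `μ(k↮A∖k)·Δ_0(A∖k) ≥ μ(k↮A∖k, k↔0)·Δ_k(A∖k)`; add.
With prim-ineq-prove-1's `CSH.cshAll` (Theorem 1 of the memo, landed in `…CSHTheoremOne.lean`) the hypothesis is discharged: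
`PreFKGSurplus.kn_conj4_holds` — **Kozma–Nitzan's Conjecture 4 for EVERY relay set on every finite graph with non-degenerate weights, unconditionally** —
and `PreFKGSurplus.kn_conj2_holds` — Conjecture 2 / display (3) (`∃ a ∈ A, P(a↔b, 0↔A) ≤ P(0↔b, 0↔A)`) for every `|A|`.
[cite: KozmaNitzan2024, Conj. 4 and Thms. 7–9 (p. 32), Conj. 2 (p. 3), Question 7 (p. 36)] [cite: VandenbergHaggstromKahn2005, Thm. 1.3 (p. 6), §2.1 Lemma 2.4 (p. 10)]
-/

noncomputable section

namespace Summit.CriticalPhenomena.PercolationContinuityZ3.Theorems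

open MeasureTheory Set Literature.Probability.LatticeModels Literature.Probability.Percolation
open scoped Classical
open KNPreFKG CSH

namespace PreFKGSurplus

variable {n : ℕ}

/-- **Kozma–Nitzan's Conjecture 4 (pre-FKG) for EVERY relay set, from the conditioned slack hierarchy.**  Non-degenerate weights; the
hypothesis `hCSH` is prim-hp-8's Theorem 1 (CSH for every owner, avoided set, decoy list and observer pair with distinct named vertices).  Then for
every `A`, every `0` and every monotone `F`, some `a ∈ A` — any relay of least mean, or `0` itself if `0 ∈ A` — has
`E[F(C(a)); 0 ↔ A] ≤ E[F(C(0)); 0 ↔ A]`.  (Hence Conjecture 2 / display (3) and Question 7 for every `|A|`.)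
[cite: KozmaNitzan2024, Conj. 4 (p. 32), Conj. 2 (p. 3), Question 7 (p. 36)] [cite: VandenbergHaggstromKahn2005, Thm. 1.3 (p. 6), §2.1 Lemma 2.4 (p. 10)] -/
theorem kn_conj4_of_csh (w : Sym2 (Fin n) → unitInterval) (hw : ∀ e, 0 < w e ∧ w e < 1)
    (hCSH : ∀ (o v x : Fin n) (Y : Finset (Fin n)) (D : List (Fin n)),
      o ≠ v → x ∉ Y → o ≠ x → v ≠ x → o ∉ Y → v ∉ Y → D.Nodup → (∀ d ∈ D, d ≠ x ∧ d ∉ Y ∧ d ≠ o ∧ d ≠ v) →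
      CSHHolds w x (↑Y : Set (Fin n)) D o v)
    (A : Finset (Fin n)) (o : Fin n) (F : Set (Fin n) → ℝ) (hF : ∀ S T : Set (Fin n), S ⊆ T → F S ≤ F T) (hA : A.Nonempty) :
    ∃ a ∈ A, ∫ ω in ⋃ a' ∈ A, openConn o a', F (openCluster ω a) ∂(prodBernoulli w) ≤
      ∫ ω in ⋃ a' ∈ A, openConn o a', F (openCluster ω o) ∂(prodBernoulli w) := by
  classical
  set μ := prodBernoulli w with hμ
  have hmeas : ∀ S : Set (BondConfig (Fin n)), MeasurableSet S := fun _ => MeasurableSet.of_discrete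
  have hint : ∀ (g : BondConfig (Fin n) → ℝ), Integrable g μ := fun g => Integrable.of_finite
  by_cases hoA : o ∈ A
  · exact ⟨o, hoA, le_rfl⟩
  obtain ⟨c, hcA, hcmin⟩ := Finset.exists_min_image A (fun u => ∫ ω, F (openCluster ω u) ∂μ) hA
  refine ⟨c, hcA, ?_⟩
  -- it suffices that `Δ_o(A) ≥ 0`
  suffices hΔ : 0 ≤ ∫ ω in ⋃ a' ∈ A, openConn o a', (F (openCluster ω o) - F (openCluster ω c)) ∂μ by
    rw [integral_sub (hint _).integrableOn (hint _).integrableOn] at hΔ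
    linarith
  -- peel one relay `k ≠ c` off `X := A` (no induction is needed at this stage: the two-observer margin does the work)
  have main : ∀ (X : Finset (Fin n)), X ⊆ A → c ∈ X →
      0 ≤ ∫ ω in ⋃ a' ∈ X, openConn o a', (F (openCluster ω o) - F (openCluster ω c)) ∂μ := by
    intro X hXA hcX
    have hoX : o ∉ X := fun h => hoA (hXA h)
    rcases (X.erase c).eq_empty_or_nonempty with h0 | hne
    · have hXc : X = {c} := by rw [← Finset.insert_erase hcX, h0]; rfl
      rw [hXc]
      have hU : (⋃ a ∈ ({c} : Finset (Fin n)), (openConn o a : Set (BondConfig (Fin n)))) = openConn o c := by ext ω; simp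
      rw [hU, setIntegral_congr_fun (hmeas _) (g := fun _ => (0 : ℝ)) (fun ω hω => by
        show F (openCluster ω o) - F (openCluster ω c) = 0
        rw [openCluster_eq_of_reach (show (openGraph ω).Reachable o c from hω), sub_self])]
      simp
    obtain ⟨k, hk⟩ := hne
    have hkc : k ≠ c := (Finset.mem_erase.1 hk).1
    have hkX : k ∈ X := (Finset.mem_erase.1 hk).2
    set X' : Finset (Fin n) := X.erase k with hX'
    have hX'X : ∀ a ∈ X', a ∈ X := fun a ha => Finset.mem_of_mem_erase ha
    have hkX' : k ∉ X' := Finset.notMem_erase k X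
    have hcX' : c ∈ X' := Finset.mem_erase.2 ⟨hkc.symm, hcX⟩
    have hko : o ≠ k := fun h => hoX (h ▸ hkX)
    have hmk : ∫ ω, F (openCluster ω c) ∂μ ≤ ∫ ω, F (openCluster ω k) ∂μ := hcmin k (hXA hkX)
    set Dk : Set (BondConfig (Fin n)) := {ω : BondConfig (Fin n) | ∀ a ∈ (↑X' : Set (Fin n)), ¬ (openGraph ω).Reachable k a}
      with hDk
    set gk : BondConfig (Fin n) → ℝ := fun ω => F (openCluster ω k) - F (openCluster ω c) with hgk
    set Gk : Set (Sym2 (Fin n)) → ℝ := fun K => F {z | z = k ∨ ∃ e ∈ K, z ∈ e} -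
      ∫ η, F (openCluster (η \ BHK2006.barOf {k} K) c) ∂μ with hGk
    have hGk_mono : Monotone Gk := CovTau.monotone_projFun w c k F hF
    set Δo : ℝ := ∫ ω in ⋃ a' ∈ X', openConn o a', (F (openCluster ω o) - F (openCluster ω c)) ∂μ with hΔo
    set Δk : ℝ := ∫ ω in ⋃ a' ∈ X', openConn k a', (F (openCluster ω k) - F (openCluster ω c)) ∂μ with hΔk
    set Tko : ℝ := ∫ ω in Dk ∩ openConn k o, gk ω ∂μ with hTko
    set J : ℝ := ∫ ω in Dk, gk ω ∂μ with hJ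
    set M : ℝ := μ.real Dk with hM
    set E : ℝ := μ.real (Dk ∩ openConn k o) with hE
    -- peel
    have hpeel : ∫ ω in ⋃ a' ∈ X, openConn o a', (F (openCluster ω o) - F (openCluster ω c)) ∂μ = Δo + Tko := by
      rw [hΔo, hTko, hgk]
      exact preSurplus_erase_add w X F c k o hkX
    -- tower identities
    have hDk_S : ∀ u : Fin n, Dk ∩ openConn k u =
        {ω : BondConfig (Fin n) | ¬ (openGraph ω).Reachable k c} ∩
          {ω | openEdgeCluster ω k ∈ {K : Set (Sym2 (Fin n)) |
            (∀ a ∈ X', a ≠ c → ¬ (a = k ∨ ∃ e ∈ K, a ∈ e)) ∧ (u = k ∨ ∃ e ∈ K, u ∈ e)}} := by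
      intro u; ext ω
      simp only [mem_inter_iff, hDk, mem_setOf_eq, Finset.mem_coe]
      constructor
      · rintro ⟨h1, h2⟩
        refine ⟨h1 c hcX', fun a ha _ => ?_, (reachable_iff_exists_mem_openEdgeCluster ω k u).1 h2⟩
        rw [← reachable_iff_exists_mem_openEdgeCluster]; exact h1 a ha
      · rintro ⟨h1, h2, h3⟩
        refine ⟨fun a ha => ?_, (reachable_iff_exists_mem_openEdgeCluster ω k u).2 h3⟩
        by_cases hac : a = c
        · rw [hac]; exact h1
        · rw [reachable_iff_exists_mem_openEdgeCluster]; exact h2 a ha hac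
    have hDk_0 : Dk = {ω : BondConfig (Fin n) | ¬ (openGraph ω).Reachable k c} ∩
          {ω | openEdgeCluster ω k ∈ {K : Set (Sym2 (Fin n)) | ∀ a ∈ X', a ≠ c → ¬ (a = k ∨ ∃ e ∈ K, a ∈ e)}} := by
      ext ω
      simp only [mem_inter_iff, hDk, mem_setOf_eq, Finset.mem_coe]
      constructor
      · intro h1
        refine ⟨h1 c hcX', fun a ha _ => ?_⟩
        rw [← reachable_iff_exists_mem_openEdgeCluster]; exact h1 a ha
      · rintro ⟨h1, h2⟩ a ha
        by_cases hac : a = c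
        · rw [hac]; exact h1
        · rw [reachable_iff_exists_mem_openEdgeCluster]; exact h2 a ha hac
    have towO : Tko = ∫ ω in Dk ∩ openConn k o, Gk (openEdgeCluster ω k) ∂μ := by
      simp only [hTko, hgk]; rw [hDk_S o]; exact CovTau.setIntegral_sub_eq_projFun w c k F _
    have tow0 : J = ∫ ω in Dk, Gk (openEdgeCluster ω k) ∂μ := by
      simp only [hJ, hgk]; rw [hDk_0]; exact CovTau.setIntegral_sub_eq_projFun w c k F _
    have hJtot : J = ((∫ ω, F (openCluster ω k) ∂μ) - ∫ ω, F (openCluster ω c) ∂μ) - Δk := by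
      have h1 := integral_add_compl (hmeas Dk) (hint gk)
      have hDkc : Dkᶜ = ⋃ a' ∈ X', (openConn k a' : Set (BondConfig (Fin n))) := by
        ext ω
        rw [mem_iUnion_openConn, mem_compl_iff, hDk]
        simp only [mem_setOf_eq, Finset.mem_coe, not_forall, not_not, exists_prop]
      have h2 : ∫ ω in Dkᶜ, gk ω ∂μ = Δk := by
        rw [hDkc]
      have h3 : ∫ ω, gk ω ∂μ = (∫ ω, F (openCluster ω k) ∂μ) - ∫ ω, F (openCluster ω c) ∂μ := by
        rw [hgk, integral_sub (hint _) (hint _)]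
      rw [hJ]; linarith
    -- one-cluster positive association for `C_k` given `k ↮ X'`:  `M·Tko ≥ J·E`
    have hG : Monotone ((connFamily k o).indicator (1 : Set (Sym2 (Fin n)) → ℝ)) :=
      monotone_indicator_one_of_isUpperSet (isUpperSet_connFamily k o)
    have hPA := BHK2006_clusterConditionalPositiveAssociation_holds (Fin n) w k (↑X' : Set (Fin n)) Gk
      ((connFamily k o).indicator 1) hGk_mono hG (by exact_mod_cast hkX')
    have hind : (fun ω : BondConfig (Fin n) => (connFamily k o).indicator (1 : Set (Sym2 (Fin n)) → ℝ) (openEdgeCluster ω k)) =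
        (openConn k o : Set (BondConfig (Fin n))).indicator 1 := by
      rw [indicator_comp_openEdgeCluster (connFamily k o) k, ← openConn_eq_setOf_connFamily]
    have hI1 : ∫ ω in Dk, (connFamily k o).indicator (1 : Set (Sym2 (Fin n)) → ℝ) (openEdgeCluster ω k) ∂μ = E := by
      rw [show (fun ω => (connFamily k o).indicator (1 : Set (Sym2 (Fin n)) → ℝ) (openEdgeCluster ω k)) =
        (openConn k o : Set (BondConfig (Fin n))).indicator 1 from hind, setIntegral_indicator_one_eq]
    have hI2 : ∫ ω in Dk, Gk (openEdgeCluster ω k) * (connFamily k o).indicator (1 : Set (Sym2 (Fin n)) → ℝ) (openEdgeCluster ω k) ∂μ =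
        ∫ ω in Dk ∩ openConn k o, Gk (openEdgeCluster ω k) ∂μ := by
      have e : ∀ ω : BondConfig (Fin n), Gk (openEdgeCluster ω k) *
          (connFamily k o).indicator (1 : Set (Sym2 (Fin n)) → ℝ) (openEdgeCluster ω k) =
          Gk (openEdgeCluster ω k) * (openConn k o : Set (BondConfig (Fin n))).indicator (1 : BondConfig (Fin n) → ℝ) ω :=
        fun ω => congrArg (fun t => Gk (openEdgeCluster ω k) * t) (congrFun hind ω)
      simp_rw [e]
      exact setIntegral_mul_indicator_one μ Dk (openConn k o) _
    have hC : J * E ≤ M * Tko := by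
      have h := hPA
      rw [hI1, hI2, ← tow0, ← towO] at h
      rw [hM]
      linarith [h]
    -- the two-observer margin at `D = []`, observers `(o, k)`:  `Δo − (E/M)·Δk ≥ 0`
    have hpm := preMargin_nonneg_of_csh w hw o k
      (fun x Y D hxY hox hkx hoY hkY hD hDd => hCSH o k x Y D hko hxY hox hkx hoY hkY hD hDd)
      X' c [] F hF hcX' (fun a ha => hcmin a (hXA (hX'X a ha))) (fun h => hoX (hX'X o h)) hkX' List.nodup_nil
      (fun d hd => by simp at hd)
    simp only [decoyList, cshMarg_nil] at hpm
    -- identify the constant `obsConst w o k (↑X' ∪ ∅) = E / M`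
    have hset0 : ((↑X' : Set (Fin n)) ∪ {d | d ∈ ([] : List (Fin n))}) = ↑X' := by simp
    have hp0 : obsConst w o k ((↑X' : Set (Fin n)) ∪ {d | d ∈ ([] : List (Fin n))}) = E / M := by
      rw [hset0, obsConst, hE, hM, hDk, openConn_symm o k]
    rw [hp0] at hpm
    -- hpm : 0 ≤ Δo − (E/M)·Δk
    have hMpos : 0 < M := by
      refine prodBernoulli_real_pos_of_nonempty hw ⟨∅, ?_⟩
      intro a ha h
      rw [HullPort.reachable_empty_iff] at h
      exact hkX' (h ▸ (Finset.mem_coe.1 ha))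
    have hE0 : 0 ≤ E := measureReal_nonneg
    have hpm' : E * Δk ≤ M * Δo := by
      have : 0 ≤ M * (Δo - E / M * Δk) := mul_nonneg hMpos.le hpm
      have e : M * (Δo - E / M * Δk) = M * Δo - E * Δk := by field_simp
      linarith [this, e]
    -- induction hypothesis is not even needed beyond the margin: assemble
    have hmk' : 0 ≤ (∫ ω, F (openCluster ω k) ∂μ) - ∫ ω, F (openCluster ω c) ∂μ := by linarith [hmk]
    have hfin : 0 ≤ M * (Δo + Tko) := by
      have hJE : J * E = ((∫ ω, F (openCluster ω k) ∂μ) - ∫ ω, F (openCluster ω c) ∂μ) * E - Δk * E := by rw [hJtot]; ring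
      nlinarith [hC, hpm', hJE, mul_nonneg hmk' hE0]
    rw [hpeel]
    exact le_of_mul_le_mul_left (by rw [mul_zero]; exact hfin) hMpos
  exact main A (subset_refl A) hcA

/-- **KOZMA–NITZAN'S CONJECTURE 4, for every relay set, unconditionally** (finite graph, non-degenerate weights, `F` monotone on vertex sets):
some `a ∈ A` has `E[F(C(a)); 0 ↔ A] ≤ E[F(C(0)); 0 ↔ A]`.  (= `kn_conj4_of_csh` with prim-ineq-prove-1's `CSH.cshAll`, i.e. prim-hp-8's Theorem 1.)
-- TODO(general form): weights in `[0,1]` (closure over degenerate weights by continuity and finiteness of `A`).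
[cite: KozmaNitzan2024, Conj. 4 (p. 32)] -/
theorem kn_conj4_holds (w : Sym2 (Fin n) → unitInterval) (hw : ∀ e, 0 < w e ∧ w e < 1)
    (A : Finset (Fin n)) (o : Fin n) (F : Set (Fin n) → ℝ) (hF : ∀ S T : Set (Fin n), S ⊆ T → F S ≤ F T) (hA : A.Nonempty) :
    ∃ a ∈ A, ∫ ω in ⋃ a' ∈ A, openConn o a', F (openCluster ω a) ∂(prodBernoulli w) ≤
      ∫ ω in ⋃ a' ∈ A, openConn o a', F (openCluster ω o) ∂(prodBernoulli w) :=
  kn_conj4_of_csh w hw (CSH.cshAll n w hw) A o F hF hA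

/-- **KOZMA–NITZAN'S CONJECTURE 2 (the pre-FKG display (3)), for every relay set, unconditionally** (non-degenerate weights): for every `b`,
some `a ∈ A` has `P(a ↔ b, 0 ↔ A) ≤ P(0 ↔ b, 0 ↔ A)` — Conjecture 4 for `F = 1{b ∈ ·}` (`KozmaNitzan2024_conjecture2_of_conjecture4_indicator`).
[cite: KozmaNitzan2024, Conj. 2 / display (3) (p. 3), p. 32 (sentence after Conjecture 4)] -/
theorem kn_conj2_holds (w : Sym2 (Fin n) → unitInterval) (hw : ∀ e, 0 < w e ∧ w e < 1)
    (A : Finset (Fin n)) (o b : Fin n) (hA : A.Nonempty) :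
    ∃ a ∈ A, (prodBernoulli w).real (openConn a b ∩ ⋃ a' ∈ A, openConn o a') ≤
      (prodBernoulli w).real (openConn o b ∩ ⋃ a' ∈ A, openConn o a') := by
  classical
  refine KozmaNitzan2024_conjecture2_of_conjecture4_indicator w A o b ?_
  have hF : ∀ S T : Set (Fin n), S ⊆ T → (fun S : Set (Fin n) => if b ∈ S then (1 : ℝ) else 0) S ≤
      (fun S : Set (Fin n) => if b ∈ S then (1 : ℝ) else 0) T := by
    intro S T hST
    by_cases hS : b ∈ S
    · simp [hS, hST hS]
    · by_cases hT : b ∈ T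
      · simp [hS, hT]
      · simp [hS, hT]
  exact kn_conj4_holds w hw A o (fun S => if b ∈ S then (1 : ℝ) else 0) hF hA

end PreFKGSurplus

end Summit.CriticalPhenomena.PercolationContinuityZ3.Theorems

end
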